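import Mathlib
import Literature.IUT.LogVolume.UnitLogNormTrace
import Literature.IUT.LogVolume.UnitLogKernel
import Literature.NumberTheory.NumberFields.CMFieldHilbert90

/-!
# Stub ideation k3-g34 — `stub_heegnerIndexLowerAtTwo` (HOME family 3 «probe the extremes»;
director technique «decomposition: split into sub-stubs with a provable glue»)

Node: R205′ of `STUB-PLAN-stub_heegnerIndexLowerAtTwo.md` v6.4 (row 96: what REMAINS of row 93's
instantiation list R205 after k3-g33 — items (iii), (v), (vii)) — the CARRIER side of the
keyed torus lemma that the one-layer Λ₂-package of record (k3-g32 `conductorFour_package`,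
`conductorEight_package`) CONSUMES as its hypothesis `h : (range g).map ev_n = 𝔪·(Λ₂/ω_n)` (resp. `= ⊤`):

* (iii) the sandwich `D_n ⊆ U_n ⊆ S_n` for the universal norms `U_n := Im(M(key)_v → S_n)`,
* (v)  `(S-T)` the keyed logarithm `g` is injective on `M(key)_v = lim_N S_m`,
* (vii) naturality `(range g).map ev_n = g_n(U_n)`.

THE SPLIT (sub-stubs, each typed below) and THE GLUE (all `sorry`-free here):

* §0  abstract ℕ-towers `t m : A (m+1) → A m`: coherent sequences, `univNorm`, and the two sandwich
      inclusions — `D n ⊆ univNorm` from «`t` maps `D (m+1)` ONTO `D m`» (coherent lift, by induction on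
      the level with a tower SHIFT, no compactness), `univNorm ⊆ D n` from «`t (S (m+1)) ⊆ D m`»; and the
      limit form of `(S-T)`: a coherent sequence of fourth roots of unity is trivial (`coherent_eq_one`).
* §1  the square: `ev ∘ g = ℓ ∘ π` + sandwich + the k3-g31 level law `ℓ(D) = A` ⇒ `h`
      (`level_hypothesis_of_tower'`: with the exact probe the law is needed on `D` ONLY — the seam
      coset never enters, E3′ structurally; `level_hypothesis_of_tower`: the variant with `ℓ(S) = A`).
* §2  quadratic algebra (Mathlib `Algebra.norm`): `N(ζ)² = 1` for `ζ⁴ = 1`, `N(±1) = 1` in degree 2.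
* §3  one unramified quadratic STEP `k = L_m ⊆ k' = L_{m+1}` of `2`-adic fields in the tree's
      `LogVolume` frame (`unitLog`, `IsPrincipal`): the sets `S = normOneUnits σ`, `D = prQuot σ`;
      `N(D') ⊇ D` from the sub-stub `NormOntoPrincipal` (Serre, Local Fields V §2 Prop. 3 (a)) and the
      PROVED equivariance `N ∘ σ' = σ ∘ N`; `N(S') ⊆ S`; the EXTREME PROBE `N(S') ⊆ D` (Hilbert 90 for the
      involution `σ'`, tree `exists_eq_mul_inv_map_of_mul_map_eq_one`, + `e = 2` bookkeeping), i.e.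
      `N(S_{m+1}) = D_m` EXACTLY and hence `U_n = D_n`; the level naturality
      `g(N z) = Tr (g' z)` from the tree's `unitLog_norm_eq_trace_unitLog`, and `σ(g x) = g x`
      (`g` lands in the fixed field `F_m`, tree `unitLog_map` / `unitLog_inv`).
* §4  the whole tower `L : ℕ → Type` (`[∀ m, Algebra (L m) (L (m+1))]`): `D_n ⊆ U_n`
      (`tower_prQuot_subset_univNorm`), `U_n = D_n` (`tower_univNorm_eq_prQuot`), `(S-T)` on the limit
      (`tower_coherent_eq_one`).

(MOD) — the `Λ₂`-module structure on `lim_N S_m` and the `Λ₂`-linearity of `g` — is NOT typed here: it is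
the one-variable replica of the tree's `IwasawaDual.IsLocNil₂.selfModule` / `invLimit` /
`semilocalUnitData₂` construction (layers `S_m/S_m^{2^{k+1}}`, `T ↦ γ − 1`), named in the card.

Nothing here is a theorem about elliptic curves; BSD is NOT proved here (nor is the stub): this file
types a decomposition of ONE instantiation node and proves its glue.
-/

set_option linter.dupNamespace false

namespace Summit.BirchSwinnertonDyer.BirchSwinnertonDyer.Cruxes.SplitBadTwoLowerHalfOfFacts.CarrierSquareK3G34

universe u

/-! ## §0 Abstract ℕ-towers: coherent sequences, universal norms, the sandwich -/

section Tower

variable {A : ℕ → Type u}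

/-- A sequence `x m : A m` is COHERENT for the transitions `t m : A (m+1) → A m` (the norms
`N_{L_{m+1}/L_m}`) when `t m (x (m+1)) = x m` for all `m`: an element of `lim_N A_m`. -/
def IsCoherent (t : ∀ m, A (m + 1) → A m) (x : ∀ m, A m) : Prop :=
  ∀ m, t m (x (m + 1)) = x m

/-- UNIVERSAL NORMS at level `n`: the values at `n` of the coherent sequences living in the level sets
`S m` — `U_n := Im(lim_N S_m → S_n)`. -/
def univNorm (t : ∀ m, A (m + 1) → A m) (S : ∀ m, Set (A m)) (n : ℕ) : Set (A n) :=
  {a | ∃ x : ∀ m, A m, IsCoherent t x ∧ (∀ m, x m ∈ S m) ∧ x n = a}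

/-- `U_n ⊆ S_n` (the trivial half of the sandwich). -/
theorem univNorm_subset (t : ∀ m, A (m + 1) → A m) (S : ∀ m, Set (A m)) (n : ℕ) :
    univNorm t S n ⊆ S n := by
  rintro a ⟨x, -, hS, rfl⟩
  exact hS n

/-- Coherent lift UPWARD from level `0`: if every element of `D m` is hit by `t m` from `D (m+1)`,
every `d ∈ D 0` starts a coherent sequence in `D` (dependent choice along the tower; pattern of
k3-g30 `exists_coherent_of_forall_exists_lift`, here seeded at a prescribed `d`). -/
theorem exists_coherent_through_zero (t : ∀ m, A (m + 1) → A m) (D : ∀ m, Set (A m))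
    (honto : ∀ m, ∀ a ∈ D m, ∃ b ∈ D (m + 1), t m b = a) {d : A 0} (hd : d ∈ D 0) :
    ∃ x : ∀ m, A m, IsCoherent t x ∧ (∀ m, x m ∈ D m) ∧ x 0 = d := by
  classical
  let step : ∀ m, {a : A m // a ∈ D m} → {b : A (m + 1) // b ∈ D (m + 1)} := fun m a =>
    ⟨(honto m a.1 a.2).choose, (honto m a.1 a.2).choose_spec.1⟩
  have hstep : ∀ m (a : {a : A m // a ∈ D m}), t m (step m a).1 = a.1 := fun m a =>
    (honto m a.1 a.2).choose_spec.2
  let seq : ∀ m, {a : A m // a ∈ D m} := fun m =>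
    Nat.rec (motive := fun m => {a : A m // a ∈ D m}) ⟨d, hd⟩ (fun m a => step m a) m
  refine ⟨fun m => (seq m).1, fun m => ?_, fun m => (seq m).2, rfl⟩
  show t m (seq (m + 1)).1 = (seq m).1
  exact hstep m (seq m)

/-- Coherent lift THROUGH ANY LEVEL `n` (no compactness, no Mittag-Leffler): induction on `n`,
applying the level-`0` case to the SHIFTED tower `m ↦ A (m+1)` and extending downward by one
application of `t 0`.  Hypotheses: `D m ⊆ S m`, `t` maps `S (m+1)` into `S m`, and `t` maps
`D (m+1)` ONTO `D m`. -/
theorem exists_coherent_through :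
    ∀ (n : ℕ) {A : ℕ → Type u} (t : ∀ m, A (m + 1) → A m) (S D : ∀ m, Set (A m)),
      (∀ m, D m ⊆ S m) → (∀ m, ∀ a ∈ S (m + 1), t m a ∈ S m) →
      (∀ m, ∀ a ∈ D m, ∃ b ∈ D (m + 1), t m b = a) →
      ∀ d ∈ D n, ∃ x : ∀ m, A m, IsCoherent t x ∧ (∀ m, x m ∈ S m) ∧ x n = d := by
  intro n
  induction n with
  | zero =>
    intro A t S D hDS _ honto d hd
    obtain ⟨x, hx, hD, h0⟩ := exists_coherent_through_zero t D honto hd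
    exact ⟨x, hx, fun m => hDS m (hD m), h0⟩
  | succ n ih =>
    intro A t S D hDS htS honto d hd
    obtain ⟨x', hx', hS', hn⟩ := ih (A := fun m => A (m + 1)) (fun m => t (m + 1))
      (fun m => S (m + 1)) (fun m => D (m + 1)) (fun m => hDS (m + 1)) (fun m => htS (m + 1))
      (fun m => honto (m + 1)) d hd
    refine ⟨fun m => match m with
      | 0 => t 0 (x' 0)
      | m + 1 => x' m, ?_, ?_, hn⟩
    · intro m
      cases m with
      | zero => rfl
      | succ m => exact hx' m
    · intro m
      cases m with
      | zero => exact htS 0 _ (hS' 0)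
      | succ m => exact hS' m

/-- **K3_LOWER's carrier half, abstractly: `D_n ⊆ U_n`.**  If the transitions map `D (m+1)` ONTO
`D m` (for the keyed torus: `N_{L_{m+1}/L_m}` maps `(1-σ)U¹(L_{m+1})` onto `(1-σ)U¹(L_m)`, from Serre
V §2 Prop. 3 (a) and `N ∘ σ = σ ∘ N`), then every element of `D n` is a universal norm. -/
theorem subset_univNorm_of_onto (t : ∀ m, A (m + 1) → A m) (S D : ∀ m, Set (A m))
    (hDS : ∀ m, D m ⊆ S m) (htS : ∀ m, ∀ a ∈ S (m + 1), t m a ∈ S m)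
    (honto : ∀ m, ∀ a ∈ D m, ∃ b ∈ D (m + 1), t m b = a) (n : ℕ) :
    D n ⊆ univNorm t S n :=
  fun d hd => exists_coherent_through n t S D hDS htS honto d hd

/-- **The extreme probe, abstractly: `U_n ⊆ D_n`.**  If the transitions map `S (m+1)` INTO `D m`
(for the keyed torus: `N(S_{m+1}) ⊆ (1-σ)U¹(L_m)`, Hilbert 90 + `e = 2`), every universal norm lies
in `D n` — one step up suffices. -/
theorem univNorm_subset_of_image_subset (t : ∀ m, A (m + 1) → A m) (S D : ∀ m, Set (A m))
    (hSD : ∀ m, ∀ a ∈ S (m + 1), t m a ∈ D m) (n : ℕ) : univNorm t S n ⊆ D n := by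
  rintro a ⟨x, hx, hS, rfl⟩
  rw [← hx n]
  exact hSD n _ (hS (n + 1))

/-- **`U_n = D_n` exactly** when `t (S (m+1)) = D m` at every step (both probes together). -/
theorem univNorm_eq (t : ∀ m, A (m + 1) → A m) (S D : ∀ m, Set (A m))
    (hDS : ∀ m, D m ⊆ S m) (hSD : ∀ m, ∀ a ∈ S (m + 1), t m a ∈ D m)
    (honto : ∀ m, ∀ a ∈ D m, ∃ b ∈ D (m + 1), t m b = a) (n : ℕ) :
    univNorm t S n = D n :=
  Set.Subset.antisymm (univNorm_subset_of_image_subset t S D hSD n)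
    (subset_univNorm_of_onto t S D hDS (fun m a ha => hDS m (hSD m a ha)) honto n)

/-- **`(S-T)` is a LIMIT phenomenon.**  A coherent sequence of fourth roots of unity in a tower of
monoids whose transitions square the `μ₄` (`N ζ = ζ·τζ`, `(N ζ)² = N(ζ²) = N(±1) = 1`) and kill `±1`
(`N(±1) = (±1)² = 1`) is identically `1` — although `-1` lies in the kernel of `log` at EVERY level. -/
theorem coherent_eq_one [∀ m, Monoid (A m)] (t : ∀ m, A (m + 1) → A m) {x : ∀ m, A m}
    (hx : IsCoherent t x) (h4 : ∀ m, x m ^ 4 = 1)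
    (hN4 : ∀ m (y : A (m + 1)), y ^ 4 = 1 → t m y ^ 2 = 1)
    (hN2 : ∀ m (y : A (m + 1)), y ^ 2 = 1 → t m y = 1) (m : ℕ) : x m = 1 := by
  have h1 : x (m + 1) ^ 2 = 1 := by
    rw [← hx (m + 1)]
    exact hN4 (m + 1) _ (h4 (m + 2))
  rw [← hx m]
  exact hN2 m _ h1

/-- **`(S-T)` on the limit from the level-wise kernel**: if at every level the kernel of `ℓ m` on
`S m` consists of fourth roots of unity (tree `unitLog_eq_zero_iff`: `ker log = torsion`; k1-g31
`pow_four_eq_one_of_torsion`: no `ζ₈` when `e = 2`), a coherent sequence in `S` killed by every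
`ℓ m` is trivial.  Hence `g = (ℓ m)_m` is injective on `lim_N S_m` (a group: apply to `x·y⁻¹`). -/
theorem coherent_eq_one_of_log_eq_zero [∀ m, Monoid (A m)] {β : ℕ → Type*} [∀ m, Zero (β m)]
    (t : ∀ m, A (m + 1) → A m) (S : ∀ m, Set (A m)) (ℓ : ∀ m, A m → β m)
    (hker : ∀ m, ∀ a ∈ S m, ℓ m a = 0 → a ^ 4 = 1)
    (hN4 : ∀ m (y : A (m + 1)), y ^ 4 = 1 → t m y ^ 2 = 1)
    (hN2 : ∀ m (y : A (m + 1)), y ^ 2 = 1 → t m y = 1)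
    {x : ∀ m, A m} (hx : IsCoherent t x) (hS : ∀ m, x m ∈ S m) (h0 : ∀ m, ℓ m (x m) = 0)
    (m : ℕ) : x m = 1 :=
  coherent_eq_one t hx (fun m => hker m _ (hS m) (h0 m)) hN4 hN2 m

end Tower

/-! ## §1 The carrier square ⇒ the hypothesis `h` of the k3-g32 package -/

section Square

variable {R M Y B L : Type*} [CommRing R] [AddCommGroup M] [Module R M] [AddCommGroup Y] [Module R Y]
  [AddCommGroup B] [Module R B]

/-- If the set-theoretic range of `ev ∘ g` is the carrier of `A'` then `(range g).map ev = A'`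
(Mathlib `LinearMap.range_comp`). -/
theorem map_range_eq_of_range_eq (g : M →ₗ[R] Y) (ev : Y →ₗ[R] B) (A' : Submodule R B)
    (hsq : Set.range (fun m => ev (g m)) = (A' : Set B)) : (LinearMap.range g).map ev = A' := by
  rw [← LinearMap.range_comp]
  ext b
  rw [LinearMap.mem_range, ← SetLike.mem_coe, ← hsq, Set.mem_range]
  simp only [LinearMap.comp_apply]

/-- **THE CARRIER SQUARE ⇒ `h`.**  Data: the keyed log `g : M → Y` and `ev : Y → B = Λ₂/ω_n` (Λ₂-linear),
the level carrier `π : M → L` (`M(key)_v → S_n ⊆ L = L_n`), the level log `ℓ : L → B` (`g_n`, valued in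
`Λ₂/ω_n` after `(S-Y)`), the level sets `D ⊆ S ⊆ L`.  Hypotheses: the square `ev ∘ g = ℓ ∘ π` commutes;
`π(M) ⊆ S` (trivial half of the sandwich); `D ⊆ π(M)` (the `D_n ⊆ U_n` half, §0); the level laws
`ℓ(D) = ℓ(S) = A'` (k3-g31 `image_prQuot_eq_of_condFour/Eight`).  Conclusion: `(range g).map ev = A'`,
i.e. EXACTLY the hypothesis `h` of k3-g32 `conductorFour_package` (`A' = 𝔪·⊤`) / `conductorEight_package`
(`A' = ⊤`).  (The set-level core is k3-g32 `image_eq_of_sandwich`.) -/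
theorem level_hypothesis_of_square (g : M →ₗ[R] Y) (ev : Y →ₗ[R] B) (A' : Submodule R B)
    (π : M → L) (ℓ : L → B) (S D : Set L)
    (hsq : ∀ m, ev (g m) = ℓ (π m)) (hπS : ∀ m, π m ∈ S) (hDπ : D ⊆ Set.range π)
    (hD : ℓ '' D = (A' : Set B)) (hS : ℓ '' S = (A' : Set B)) :
    (LinearMap.range g).map ev = A' := by
  apply map_range_eq_of_range_eq
  apply Set.Subset.antisymm
  · rintro b ⟨m, rfl⟩
    rw [← hS]
    exact ⟨π m, hπS m, (hsq m).symm⟩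
  · intro b hb
    rw [← hD] at hb
    obtain ⟨d, hd, rfl⟩ := hb
    obtain ⟨m, hm⟩ := hDπ hd
    exact ⟨m, by simp only [hsq, hm]⟩

/-- **The square for a TOWER receptacle.**  If `M` carries level maps `π n : M → A n` into the `S n`
through which every coherent sequence in `S` factors (the receptacle EXHAUSTS `lim_N S_m` — the typed
form of B46's identification `U_n = Im(M(key)_v → S_n)`), and the transitions map `D (m+1)` onto `D m`,
then `D n ⊆ range (π n)`; with the square and the level laws, `h` follows at every level `n`. -/
theorem level_hypothesis_of_tower {A : ℕ → Type u} (t : ∀ m, A (m + 1) → A m)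
    (S D : ∀ m, Set (A m)) (hDS : ∀ m, D m ⊆ S m) (htS : ∀ m, ∀ a ∈ S (m + 1), t m a ∈ S m)
    (honto : ∀ m, ∀ a ∈ D m, ∃ b ∈ D (m + 1), t m b = a)
    (π : ∀ n, M → A n) (hπS : ∀ n m, π n m ∈ S n)
    (hexh : ∀ x : ∀ m, A m, IsCoherent t x → (∀ m, x m ∈ S m) → ∃ m : M, ∀ n, π n m = x n)
    {Bn : ℕ → Type*} [∀ n, AddCommGroup (Bn n)] [∀ n, Module R (Bn n)]
    (g : M →ₗ[R] Y) (ev : ∀ n, Y →ₗ[R] Bn n) (ℓ : ∀ n, A n → Bn n) (A' : ∀ n, Submodule R (Bn n))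
    (hsq : ∀ n m, ev n (g m) = ℓ n (π n m))
    (hD : ∀ n, ℓ n '' D n = (A' n : Set (Bn n))) (hS : ∀ n, ℓ n '' S n = (A' n : Set (Bn n)))
    (n : ℕ) : (LinearMap.range g).map (ev n) = A' n := by
  refine level_hypothesis_of_square g (ev n) (A' n) (π n) (ℓ n) (S n) (D n) (hsq n) (hπS n) ?_
    (hD n) (hS n)
  intro d hd
  obtain ⟨x, hx, hxS, hxn⟩ := subset_univNorm_of_onto t S D hDS htS honto n hd
  obtain ⟨m, hm⟩ := hexh x hx hxS
  exact ⟨m, by rw [hm n, hxn]⟩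

/-- **THE SQUARE WITH THE EXACT PROBE** (no level law on `S`, only on `D`): if the receptacle's
level image lies in `D` (because `U_n ⊆ D_n`, §0 `univNorm_subset_of_image_subset`) and contains `D`
(`D_n ⊆ U_n`), then `(range g).map ev = A'` from the law `ℓ(D) = A'` ALONE — the seam coset
`log ζ + ℓ(D)` (`ζ = ϖ/σϖ`) never enters, at ANY `(u, n)` including `(3, 0)` (E3′ structurally). -/
theorem level_hypothesis_of_square' (g : M →ₗ[R] Y) (ev : Y →ₗ[R] B) (A' : Submodule R B)
    (π : M → L) (ℓ : L → B) (D : Set L)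
    (hsq : ∀ m, ev (g m) = ℓ (π m)) (hπD : ∀ m, π m ∈ D) (hDπ : D ⊆ Set.range π)
    (hD : ℓ '' D = (A' : Set B)) :
    (LinearMap.range g).map ev = A' :=
  level_hypothesis_of_square g ev A' π ℓ D D hsq hπD hDπ hD hD

/-- **The tower square with the exact probe.**  Hypotheses: the receptacle `M` maps to COHERENT
sequences in `S` (`hπcoh`, `hπS`) and exhausts them (`hexh` — B46 typed); the transitions send
`S (m+1)` INTO `D m` (`hSD`: `N(S_{m+1}) ⊆ (1-σ)U¹(L_m)`, §3 `norm_normOneUnits_subset_prQuot`) and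
`D (m+1)` ONTO `D m` (`honto`: §3 `prQuot_subset_norm_image`); ONE level law `ℓ_n(D_n) = A'_n`
(k3-g31, cited).  Conclusion: k3-g32's hypothesis `h` at every level `n`. -/
theorem level_hypothesis_of_tower' {A : ℕ → Type u} (t : ∀ m, A (m + 1) → A m)
    (S D : ∀ m, Set (A m)) (hDS : ∀ m, D m ⊆ S m)
    (hSD : ∀ m, ∀ a ∈ S (m + 1), t m a ∈ D m)
    (honto : ∀ m, ∀ a ∈ D m, ∃ b ∈ D (m + 1), t m b = a)
    (π : ∀ n, M → A n) (hπS : ∀ n m, π n m ∈ S n) (hπcoh : ∀ m : M, IsCoherent t (fun n => π n m))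
    (hexh : ∀ x : ∀ m, A m, IsCoherent t x → (∀ m, x m ∈ S m) → ∃ m : M, ∀ n, π n m = x n)
    {Bn : ℕ → Type*} [∀ n, AddCommGroup (Bn n)] [∀ n, Module R (Bn n)]
    (g : M →ₗ[R] Y) (ev : ∀ n, Y →ₗ[R] Bn n) (ℓ : ∀ n, A n → Bn n) (A' : ∀ n, Submodule R (Bn n))
    (hsq : ∀ n m, ev n (g m) = ℓ n (π n m))
    (hD : ∀ n, ℓ n '' D n = (A' n : Set (Bn n))) (n : ℕ) :
    (LinearMap.range g).map (ev n) = A' n := by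
  refine level_hypothesis_of_square' g (ev n) (A' n) (π n) (ℓ n) (D n) (hsq n) ?_ ?_ (hD n)
  · intro m
    exact univNorm_subset_of_image_subset t S D hSD n ⟨fun k => π k m, hπcoh m, fun k => hπS k m, rfl⟩
  · intro d hd
    have htS : ∀ m, ∀ a ∈ S (m + 1), t m a ∈ S m := fun m a ha => hDS m (hSD m a ha)
    obtain ⟨x, hx, hxS, hxn⟩ := subset_univNorm_of_onto t S D hDS htS honto n hd
    obtain ⟨m, hm⟩ := hexh x hx hxS
    exact ⟨m, by rw [hm n, hxn]⟩

end Square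

/-! ## §2 Quadratic algebra for the transitions (Mathlib `Algebra.norm`) -/

section Quadratic

variable {F E : Type*} [Field F] [Field E] [Algebra F E]

/-- `y⁴ = 1 ⇒ y² = ±1` in a field. -/
theorem sq_eq_one_or_eq_neg_one_of_pow_four {y : E} (h : y ^ 4 = 1) : y ^ 2 = 1 ∨ y ^ 2 = -1 := by
  have h' : (y ^ 2 - 1) * (y ^ 2 + 1) = 0 := by ring_nf; rw [h]; ring
  rcases mul_eq_zero.mp h' with h1 | h1
  · exact Or.inl (sub_eq_zero.mp h1)
  · exact Or.inr (eq_neg_of_add_eq_zero_left h1)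

/-- `N_{E/F}(-1) = 1` in degree `2`. -/
theorem norm_neg_one_of_finrank_two (h2 : Module.finrank F E = 2) : Algebra.norm F (-1 : E) = 1 := by
  have : (-1 : E) = algebraMap F E (-1) := by simp
  rw [this, Algebra.norm_algebraMap, h2]
  norm_num

/-- `y² = 1 ⇒ N_{E/F}(y) = 1` in degree `2` (`y = ±1`): the transitions KILL `±1`. -/
theorem norm_eq_one_of_sq_eq_one (h2 : Module.finrank F E = 2) {y : E} (h : y ^ 2 = 1) :
    Algebra.norm F y = 1 := by
  have h' : y * y = 1 := by rw [← pow_two]; exact h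
  rcases mul_self_eq_one_iff.mp h' with rfl | rfl
  · exact map_one _
  · exact norm_neg_one_of_finrank_two h2

/-- `y⁴ = 1 ⇒ N_{E/F}(y)² = 1` in degree `2`: the transitions SQUARE the `μ₄`. -/
theorem norm_sq_eq_one_of_pow_four (h2 : Module.finrank F E = 2) {y : E} (h : y ^ 4 = 1) :
    Algebra.norm F y ^ 2 = 1 := by
  rw [← map_pow]
  rcases sq_eq_one_or_eq_neg_one_of_pow_four h with h1 | h1
  · rw [h1, map_one]
  · rw [h1, norm_neg_one_of_finrank_two h2]

end Quadratic

/-! ## §3 One unramified quadratic step of the dyadic tower in the `LogVolume` frame -/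

section LevelPair

open Literature.IUT.LogVolume

variable {k k' : Type} [NontriviallyNormedField k] [NormedAlgebra ℚ_[2] k] [IsUltrametricDist k]
  [ProperSpace k] [NontriviallyNormedField k'] [NormedAlgebra ℚ_[2] k'] [IsUltrametricDist k']
  [ProperSpace k'] [Algebra k k'] [IsScalarTower ℚ_[2] k k']

/-- `S = U¹(L)^{N_{L/F}=1}`: the norm-one principal units of `(L, σ)` (`N_{L/F} x = x·σx` for the
quadratic `L/F` with involution `σ`) — the projection-free model of `H¹(F, T(key))` (B46). -/
def normOneUnits (σ : k →+* k) : Set k := {x | IsPrincipal x ∧ x * σ x = 1}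

/-- `D = (1-σ)U¹(L)`: quotients `x/σx` of principal units, written division-free (`q·σx = x`);
the same set as k3-g31 `principalQuot σ`. -/
def prQuot (σ : k →+* k) : Set k := {q | ∃ x : k, IsPrincipal x ∧ q * σ x = x}

omit [NormedAlgebra ℚ_[2] k] [ProperSpace k] in
/-- `D ⊆ S` for an isometric involution `σ`. -/
theorem prQuot_subset_normOneUnits (σ : k →+* k) (hσ2 : ∀ x, σ (σ x) = x)
    (hσi : ∀ x, ‖σ x‖ = ‖x‖) : prQuot σ ⊆ normOneUnits σ := by
  rintro q ⟨x, hx, hq⟩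
  have hx1 : ‖x‖ = 1 := hx.norm_eq_one
  have hσx : IsPrincipal (σ x) := (isPrincipal_map_iff σ hσi x).mpr hx
  have hσx0 : σ x ≠ 0 := fun h => by simp [h, IsPrincipal] at hσx
  have hx0 : x ≠ 0 := fun h => by simp [h, IsPrincipal] at hx
  have hq' : q = x * (σ x)⁻¹ := by rw [eq_mul_inv_iff_mul_eq₀ hσx0]; exact hq
  refine ⟨?_, ?_⟩
  · rw [hq']; exact hx.mul hσx.inv
  · rw [hq', map_mul, map_inv₀, hσ2]
    field_simp

omit [IsUltrametricDist k] [ProperSpace k] [IsUltrametricDist k'] in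
/-- `k'/k` is finite (`k'` is finite over `ℚ₂`, being locally compact). -/
theorem moduleFinite_step : Module.Finite k k' := by
  haveI : FiniteDimensional ℚ_[2] k' := FiniteDimensional.of_locallyCompactSpace ℚ_[2]
  exact Module.Finite.of_restrictScalars_finite ℚ_[2] k k'

omit [NormedAlgebra ℚ_[2] k] [IsUltrametricDist k] [ProperSpace k] [NormedAlgebra ℚ_[2] k'] [IsUltrametricDist k']
  [ProperSpace k'] [IsScalarTower ℚ_[2] k k'] in
/-- `N(y⁻¹) = (N y)⁻¹` for `y ≠ 0`. -/
theorem norm_inv_of_ne_zero {y : k'} (hy : y ≠ 0) :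
    Algebra.norm k y⁻¹ = (Algebra.norm k y)⁻¹ :=
  eq_inv_of_mul_eq_one_left (by rw [← map_mul, inv_mul_cancel₀ hy, map_one])

/-- SUB-STUB (N-ONTO), typed: **the norm maps the principal units of `k'` ONTO those of `k`** — Serre,
*Local Fields* V §2 Prop. 3 (a) (`N(U_L^n) = U_K^n`, `n ≥ 1`, for UNRAMIFIED `L/K`; via surjectivity of
the residue trace and completeness).  The one genuinely analytic input of the node. -/
def NormOntoPrincipal (k k' : Type) [NontriviallyNormedField k] [NontriviallyNormedField k']
    [Algebra k k'] : Prop :=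
  ∀ y : k, IsPrincipal y → ∃ z : k', IsPrincipal z ∧ Algebra.norm k z = y

omit [NormedAlgebra ℚ_[2] k] [IsUltrametricDist k] [ProperSpace k] [NormedAlgebra ℚ_[2] k'] [IsUltrametricDist k']
  [ProperSpace k'] [IsScalarTower ℚ_[2] k k'] in
/-- **Equivariance `N ∘ σ' = σ ∘ N`, PROVED from commuting automorphisms.**  If `N z = z·τz` (`k'/k`
quadratic Galois with group `{1, τ}`), `σ'` restricts to `σ`, and `τσ' = σ'τ` (`Gal(L_{m+1}/F_m) ≅ (ℤ/2)²`
is abelian), then `N(σ'z) = σ(Nz)`. -/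
theorem norm_map_eq_map_norm (σ : k →+* k) (σ' : k' →+* k') (τ : k' ≃ₐ[k] k')
    (hNτ : ∀ z : k', algebraMap k k' (Algebra.norm k z) = z * τ z)
    (hσσ' : ∀ y : k, σ' (algebraMap k k' y) = algebraMap k k' (σ y))
    (hcomm : ∀ z : k', τ (σ' z) = σ' (τ z)) (z : k') :
    Algebra.norm k (σ' z) = σ (Algebra.norm k z) := by
  apply (algebraMap k k').injective
  rw [hNτ, ← hσσ', hNτ, map_mul, hcomm]

omit [IsUltrametricDist k] [IsUltrametricDist k'] [ProperSpace k'] in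
/-- `‖algebraMap k k' y‖ = ‖y‖` (embeddings of `p`-adic fields are isometries; tree `norm_map_algHom`). -/
theorem norm_algebraMap_eq' (y : k) : ‖algebraMap k k' y‖ = ‖y‖ := by
  have := norm_map_algHom (IsScalarTower.toAlgHom ℚ_[2] k k') y
  simpa using this

omit [IsUltrametricDist k] in
/-- **`N` maps principal units to principal units** (`N z = z·τz`, `τ` an isometry). -/
theorem isPrincipal_norm (τ : k' ≃ₐ[k] k')
    (hNτ : ∀ z : k', algebraMap k k' (Algebra.norm k z) = z * τ z) {z : k'} (hz : IsPrincipal z) :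
    IsPrincipal (Algebra.norm k z) := by
  have hτi : ∀ x : k', ‖τ x‖ = ‖x‖ := fun x =>
    norm_map_algHom ((τ : k' →ₐ[k] k').restrictScalars ℚ_[2]) x
  have hτz : IsPrincipal (τ z) := (isPrincipal_map_iff (τ : k' →+* k') hτi z).mpr hz
  have h : IsPrincipal (algebraMap k k' (Algebra.norm k z)) := by
    rw [hNτ]; exact hz.mul hτz
  exact (isPrincipal_map_iff (algebraMap k k') norm_algebraMap_eq' _).mp h

omit [IsUltrametricDist k] in
/-- **`N(S') ⊆ S`**: the transition maps norm-one principal units to norm-one principal units. -/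
theorem norm_mem_normOneUnits (σ : k →+* k) (σ' : k' →+* k') (τ : k' ≃ₐ[k] k')
    (hNτ : ∀ z : k', algebraMap k k' (Algebra.norm k z) = z * τ z)
    (hEqv : ∀ z : k', Algebra.norm k (σ' z) = σ (Algebra.norm k z))
    {x : k'} (hx : x ∈ normOneUnits σ') : Algebra.norm k x ∈ normOneUnits σ := by
  refine ⟨isPrincipal_norm τ hNτ hx.1, ?_⟩
  rw [← hEqv, ← map_mul, hx.2, map_one]

omit [IsUltrametricDist k] [ProperSpace k] [IsUltrametricDist k'] in
/-- **`D ⊆ N(D')` — the `K3_LOWER` step**, from (N-ONTO) and equivariance: for `q·σy = y` with `y`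
principal pick a principal `z` with `N z = y`; then `q' := z/σ'z ∈ D'` and `N q' = q`. -/
theorem prQuot_subset_norm_image (σ : k →+* k) (σ' : k' →+* k') (hN : NormOntoPrincipal k k')
    (hEqv : ∀ z : k', Algebra.norm k (σ' z) = σ (Algebra.norm k z))
    (hσ'i : ∀ x, ‖σ' x‖ = ‖x‖) :
    ∀ q ∈ prQuot σ, ∃ q' ∈ prQuot σ', Algebra.norm k q' = q := by
  haveI : Module.Finite k k' := moduleFinite_step
  rintro q ⟨y, hy, hq⟩
  obtain ⟨z, hz, rfl⟩ := hN y hy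
  have hσz : IsPrincipal (σ' z) := (isPrincipal_map_iff σ' hσ'i z).mpr hz
  have hσz0 : σ' z ≠ 0 := fun h => by simp [h, IsPrincipal] at hσz
  have hNσz0 : Algebra.norm k (σ' z) ≠ 0 := Algebra.norm_ne_zero_iff.mpr hσz0
  refine ⟨z * (σ' z)⁻¹, ⟨z, hz, by rw [inv_mul_cancel_right₀ hσz0]⟩, ?_⟩
  rw [map_mul, norm_inv_of_ne_zero hσz0, hEqv]
  rw [hEqv] at hNσz0
  -- `q · σ(Nz) = Nz` and `σ (N z) ≠ 0` give `q = Nz / σ(Nz)`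
  rw [eq_comm, eq_mul_inv_iff_mul_eq₀ hNσz0]
  exact hq

omit [ProperSpace k] [IsUltrametricDist k'] in
/-- **THE EXTREME PROBE `N(S') ⊆ D`** (`N(S_{m+1}) ⊆ (1-σ)U¹(L_m)`; with `D ⊆ N(D') ⊆ N(S')` this is
`N(S_{m+1}) = D_m` EXACTLY, the typed form of «the seam tower `S_m/D_m ≅ ℤ/2` has ZERO transitions»).
Inputs: Hilbert 90 for the involution `σ'` (tree `exists_eq_mul_inv_map_of_mul_map_eq_one`: `x·σ'x = 1 ⇒
x = b/σ'b`); equivariance; (UR) `‖N b‖ = ‖a²‖` for some `a ∈ kˣ` (unramified: `|k'ˣ| = |kˣ|`, and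
`‖N b‖ = ‖b‖²`); (FIX) every unit, and every nonzero square, of `k` is (`σ`-fixed)·(principal)
(`k/k^σ` totally ramified quadratic: equal residue fields, `v(ϖ_F) = 2`). -/
theorem norm_normOneUnits_subset_prQuot (σ : k →+* k) (σ' : k' →+* k')
    (hσ'2 : ∀ x, σ' (σ' x) = x) (hne : ∃ x, σ' x ≠ x)
    (hEqv : ∀ z : k', Algebra.norm k (σ' z) = σ (Algebra.norm k z))
    (hur : ∀ b : k', b ≠ 0 → ∃ a : k, a ≠ 0 ∧ ‖Algebra.norm k b‖ = ‖a ^ 2‖)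
    (hfixU : ∀ w : k, ‖w‖ = 1 → ∃ c y : k, σ c = c ∧ IsPrincipal y ∧ w = c * y)
    (hfixSq : ∀ a : k, a ≠ 0 → ∃ c y : k, σ c = c ∧ IsPrincipal y ∧ a ^ 2 = c * y)
    {x : k'} (hx : x ∈ normOneUnits σ') : Algebra.norm k x ∈ prQuot σ := by
  haveI : Module.Finite k k' := moduleFinite_step
  obtain ⟨b, hb0, hxb⟩ :=
    Literature.NumberTheory.NumberFields.exists_eq_mul_inv_map_of_mul_map_eq_one σ' hσ'2 hne hx.2
  -- `N x · σ(N b) = N b`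
  have hσb0 : σ' b ≠ 0 := (map_ne_zero σ').mpr hb0
  have hkey : Algebra.norm k x * σ (Algebra.norm k b) = Algebra.norm k b := by
    rw [← hEqv, ← map_mul, hxb, inv_mul_cancel_right₀ hσb0]
  -- write `N b = a² · w` with `w` a unit, then `a² = c₁ y₁`, `w = c₂ y₂`
  obtain ⟨a, ha0, hNa⟩ := hur b hb0
  have hNb0 : Algebra.norm k b ≠ 0 := Algebra.norm_ne_zero_iff.mpr hb0
  have ha20 : a ^ 2 ≠ 0 := pow_ne_zero 2 ha0
  set w : k := Algebra.norm k b * (a ^ 2)⁻¹ with hw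
  have hw1 : ‖w‖ = 1 := by
    rw [hw, norm_mul, norm_inv, hNa, mul_inv_cancel₀ (norm_ne_zero_iff.mpr ha20)]
  obtain ⟨c₁, y₁, hc₁, hy₁, ha2⟩ := hfixSq a ha0
  obtain ⟨c₂, y₂, hc₂, hy₂, hw2⟩ := hfixU w hw1
  have hNb : Algebra.norm k b = (c₁ * c₂) * (y₁ * y₂) := by
    have : Algebra.norm k b = w * a ^ 2 := by rw [hw, inv_mul_cancel_right₀ ha20]
    rw [this, hw2, ha2]; ring
  have hc0 : c₁ * c₂ ≠ 0 := by
    intro h; apply hNb0; rw [hNb, h, zero_mul]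
  refine ⟨y₁ * y₂, hy₁.mul hy₂, ?_⟩
  -- cancel the `σ`-fixed factor `c₁ c₂` from `N x · σ(c₁c₂ · y₁y₂) = c₁c₂ · y₁y₂`
  have h1 : (c₁ * c₂) * (Algebra.norm k x * σ (y₁ * y₂)) = (c₁ * c₂) * (y₁ * y₂) := by
    have := hkey
    rw [hNb, map_mul, map_mul σ c₁ c₂, hc₁, hc₂] at this
    calc (c₁ * c₂) * (Algebra.norm k x * σ (y₁ * y₂))
        = Algebra.norm k x * ((c₁ * c₂) * σ (y₁ * y₂)) := by ring
      _ = (c₁ * c₂) * (y₁ * y₂) := this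
  exact mul_left_cancel₀ hc0 h1

/-- **Level naturality of the keyed logarithm** `g_m(x) := log(x)/(2s)` (`s = √u ∈ L_0 ⊆ k ⊆ k'`):
`g_m(N z) = Tr_{k'/k}(g_{m+1} z)` for units `z` — tree `unitLog_norm_eq_trace_unitLog` (`log ∘ N = Tr ∘ log`)
and `k`-linearity of the trace.  This is the square `ev_n ∘ g = g_n ∘ π_n` one step at a time. -/
theorem keyedLog_norm_eq_trace (s : k) {z : k'} (hz : ‖z‖ = 1) :
    (2 * s)⁻¹ * unitLog (Algebra.norm k z)
      = Algebra.trace k k' ((algebraMap k k' (2 * s))⁻¹ * unitLog z) := by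
  rw [unitLog_norm_eq_trace_unitLog 2 hz, ← map_inv₀, ← Algebra.smul_def, LinearMap.map_smul,
    smul_eq_mul]

omit [NormedAlgebra ℚ_[2] k'] [IsUltrametricDist k'] [ProperSpace k'] [Algebra k k'] [IsScalarTower ℚ_[2] k k'] in
/-- **The keyed log of a norm-one unit is `σ`-FIXED** (`σ(log x /(2s)) = log(x⁻¹)/(−2s) = log x/(2s)` for
`x·σx = 1`, `σs = −s`): `g_m` lands in the fixed field `F_m = L_m^σ` — the receptacle `Y = lim_Tr 𝒪_{F_m}`
of (S-Y) is the right target (tree `unitLog_map`, `unitLog_inv`). -/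
theorem keyedLog_map_sigma (σ : k →+* k) (hσi : ∀ x, ‖σ x‖ = ‖x‖) (s : k) (hσs : σ s = -s)
    {x : k} (hx : x ∈ normOneUnits σ) :
    σ ((2 * s)⁻¹ * unitLog x) = (2 * s)⁻¹ * unitLog x := by
  have hx1 : ‖x‖ = 1 := hx.1.norm_eq_one
  have hx0 : x ≠ 0 := fun h => by simp [h] at hx1
  have hσx : σ x = x⁻¹ := eq_inv_of_mul_eq_one_right hx.2
  rw [map_mul, map_inv₀, map_mul, hσs, ← unitLog_map 2 σ hσi x, hσx, unitLog_inv 2 hx1]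
  have h2 : σ 2 = 2 := map_ofNat σ 2
  rw [h2]
  field_simp

omit [NormedAlgebra ℚ_[2] k] [IsUltrametricDist k] [ProperSpace k] [NormedAlgebra ℚ_[2] k'] [IsUltrametricDist k']
  [ProperSpace k'] [IsScalarTower ℚ_[2] k k'] in
/-- **`(S-T)` inputs at one step, discharged**: in degree `2` the norm squares `μ₄` and kills `±1`. -/
theorem normStep_pow (h2 : Module.finrank k k' = 2) :
    (∀ y : k', y ^ 4 = 1 → Algebra.norm k y ^ 2 = 1) ∧ (∀ y : k', y ^ 2 = 1 → Algebra.norm k y = 1) :=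
  ⟨fun _ hy => norm_sq_eq_one_of_pow_four h2 hy, fun _ hy => norm_eq_one_of_sq_eq_one h2 hy⟩

/-- **Level-wise kernel of the keyed log is `4`-torsion** — the shape in which k1-g31's census enters
`coherent_eq_one_of_log_eq_zero`: for a norm-one principal unit `x` with `log x = 0`, `x` is torsion (tree
`unitLog_eq_zero_iff`) and then `x⁴ = 1` by the `e = 2` census (hypothesis `h4tors`, k1-g31
`pow_four_eq_one_of_torsion`). -/
theorem pow_four_eq_one_of_keyedLog_eq_zero (σ : k →+* k) (s : k) (hs : s ≠ 0)
    (h4tors : ∀ x ∈ normOneUnits σ, ∀ n : ℕ, 0 < n → x ^ n = 1 → x ^ 4 = 1)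
    {x : k} (hx : x ∈ normOneUnits σ) (h0 : (2 * s)⁻¹ * unitLog x = 0) : x ^ 4 = 1 := by
  haveI : CharZero k := charZero_of_injective_algebraMap (algebraMap ℚ_[2] k).injective
  have h2s : (2 * s)⁻¹ ≠ 0 := inv_ne_zero (mul_ne_zero two_ne_zero hs)
  have hlog : unitLog x = 0 := (mul_eq_zero.mp h0).resolve_left h2s
  obtain ⟨n, hn, hxn⟩ := (unitLog_eq_zero_iff 2 k hx.1.norm_eq_one).mp hlog
  exact h4tors x hx n hn hxn

end LevelPair

/-! ## §4 The whole dyadic tower: `D_n ⊆ U_n` (K3_LOWER) and `U_n = D_n` (extreme probe), assembled -/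

section WholeTower

open Literature.IUT.LogVolume

variable {L : ℕ → Type} [∀ m, NontriviallyNormedField (L m)] [∀ m, NormedAlgebra ℚ_[2] (L m)]
  [∀ m, IsUltrametricDist (L m)] [∀ m, ProperSpace (L m)] [∀ m, Algebra (L m) (L (m + 1))]
  [∀ m, IsScalarTower ℚ_[2] (L m) (L (m + 1))]

/-- The norm tower `N_m : L_{m+1} → L_m`. -/
noncomputable def normT (L : ℕ → Type) [∀ m, NontriviallyNormedField (L m)] [∀ m, Algebra (L m) (L (m + 1))]
    (m : ℕ) : L (m + 1) → L m :=
  fun z => Algebra.norm (L m) z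

/-- **K3_LOWER's carrier half for the tower `L_m = F_m(√u)`: `(1-σ)U¹(L_n) ⊆ U_n`** — every element of
`D_n` is a universal norm from `lim_N S_m` — from, per step: `σ` an isometric involution, `N = 1 + τ`
with `τ` the generator of `Gal(L_{m+1}/L_m)`, the equivariance `N ∘ σ_{m+1} = σ_m ∘ N`, and the sub-stub
(N-ONTO).  Sorry-free GLUE; the open inputs are exactly `hN` (Serre V §2 Prop. 3 (a)) and the
instantiation of the frame hypotheses. -/
theorem tower_prQuot_subset_univNorm (σ : ∀ m, L m →+* L m) (hσ2 : ∀ m x, σ m (σ m x) = x)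
    (hσi : ∀ m x, ‖σ m x‖ = ‖x‖) (τ : ∀ m, L (m + 1) ≃ₐ[L m] L (m + 1))
    (hNτ : ∀ m (z : L (m + 1)), algebraMap (L m) (L (m + 1)) (Algebra.norm (L m) z) = z * τ m z)
    (hEqv : ∀ m (z : L (m + 1)), Algebra.norm (L m) (σ (m + 1) z) = σ m (Algebra.norm (L m) z))
    (hN : ∀ m, NormOntoPrincipal (L m) (L (m + 1))) (n : ℕ) :
    prQuot (σ n) ⊆ univNorm (normT L) (fun m => normOneUnits (σ m)) n := by
  refine subset_univNorm_of_onto (normT L) (fun m => normOneUnits (σ m)) (fun m => prQuot (σ m))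
    (fun m => prQuot_subset_normOneUnits (σ m) (hσ2 m) (hσi m))
    (fun m a ha => norm_mem_normOneUnits (σ m) (σ (m + 1)) (τ m) (hNτ m) (hEqv m) ha) ?_ n
  intro m q hq
  obtain ⟨q', hq', h⟩ := prQuot_subset_norm_image (σ m) (σ (m + 1)) (hN m) (hEqv m) (hσi (m + 1)) q hq
  exact ⟨q', hq', h⟩

/-- **The extreme probe for the tower: `U_n = (1-σ)U¹(L_n)` EXACTLY** (so the receptacle's image in
`S_n` is MODEL-INDEPENDENT and the seam class `π/σπ` is never a universal norm — cf. K3_EXACT, E3′),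
from, in addition: Hilbert 90 for `σ_{m+1}` (tree), (UR) and (FIX) at each step. -/
theorem tower_univNorm_eq_prQuot (σ : ∀ m, L m →+* L m) (hσ2 : ∀ m x, σ m (σ m x) = x)
    (hσi : ∀ m x, ‖σ m x‖ = ‖x‖) (hne : ∀ m, ∃ x, σ m x ≠ x)
    (hEqv : ∀ m (z : L (m + 1)), Algebra.norm (L m) (σ (m + 1) z) = σ m (Algebra.norm (L m) z))
    (hN : ∀ m, NormOntoPrincipal (L m) (L (m + 1)))
    (hur : ∀ m (b : L (m + 1)), b ≠ 0 → ∃ a : L m, a ≠ 0 ∧ ‖Algebra.norm (L m) b‖ = ‖a ^ 2‖)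
    (hfixU : ∀ m (w : L m), ‖w‖ = 1 → ∃ c y : L m, σ m c = c ∧ IsPrincipal y ∧ w = c * y)
    (hfixSq : ∀ m (a : L m), a ≠ 0 → ∃ c y : L m, σ m c = c ∧ IsPrincipal y ∧ a ^ 2 = c * y)
    (n : ℕ) : univNorm (normT L) (fun m => normOneUnits (σ m)) n = prQuot (σ n) := by
  refine univNorm_eq (normT L) (fun m => normOneUnits (σ m)) (fun m => prQuot (σ m))
    (fun m => prQuot_subset_normOneUnits (σ m) (hσ2 m) (hσi m)) ?_ ?_ n
  · intro m a ha
    exact norm_normOneUnits_subset_prQuot (σ m) (σ (m + 1)) (hσ2 (m + 1)) (hne (m + 1)) (hEqv m)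
      (hur m) (hfixU m) (hfixSq m) ha
  · intro m q hq
    obtain ⟨q', hq', h⟩ :=
      prQuot_subset_norm_image (σ m) (σ (m + 1)) (hN m) (hEqv m) (hσi (m + 1)) q hq
    exact ⟨q', hq', h⟩

omit [∀ m, IsScalarTower ℚ_[2] (L m) (L (m + 1))] in
/-- **`(S-T)` for the tower**: a norm-coherent sequence of norm-one principal units killed by every
keyed logarithm `x ↦ log(x)/(2s)` is trivial — from the level-wise `e = 2` torsion census (k1-g31) and
`[L_{m+1} : L_m] = 2`.  Hence the keyed log `g` is injective on `lim_N S_m` although `-1 ∈ ker g_m`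
at every level. -/
theorem tower_coherent_eq_one (σ : ∀ m, L m →+* L m) (s : ∀ m, L m) (hs : ∀ m, s m ≠ 0)
    (h2 : ∀ m, Module.finrank (L m) (L (m + 1)) = 2)
    (h4tors : ∀ m, ∀ x ∈ normOneUnits (σ m), ∀ j : ℕ, 0 < j → x ^ j = 1 → x ^ 4 = 1)
    {x : ∀ m, L m} (hx : IsCoherent (normT L) x) (hS : ∀ m, x m ∈ normOneUnits (σ m))
    (h0 : ∀ m, (2 * s m)⁻¹ * unitLog (x m) = 0) (m : ℕ) : x m = 1 :=
  coherent_eq_one_of_log_eq_zero (normT L) (fun m => normOneUnits (σ m))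
    (fun m y => (2 * s m)⁻¹ * unitLog y)
    (fun m _ ha h => pow_four_eq_one_of_keyedLog_eq_zero (σ m) (s m) (hs m) (h4tors m) ha h)
    (fun m y hy => (normStep_pow (h2 m)).1 y hy) (fun m y hy => (normStep_pow (h2 m)).2 y hy)
    hx hS h0 m

end WholeTower

end Summit.BirchSwinnertonDyer.BirchSwinnertonDyer.Cruxes.SplitBadTwoLowerHalfOfFacts.CarrierSquareK3G34
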